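import Summits.ResolutionOfSingularities.ResolutionOfSingularities.Theorems.EquisingularLiftEquisingularLiftNatEquinodalJacobian
import Summits.ResolutionOfSingularities.ResolutionOfSingularities.Theorems.EquisingularLiftEquisingularLiftNatNodeStrictTransformChart
import HarnessLib

/-!
# [OURS · L1 W4.5(b) · EL♮(3) · nose residue, door ν4 «EQUINODAL PLANAR NOSE», junction (D6-1) ⟶ (D6-2)]
# The NODE CHART of the equinodal lift: (S1)'s output satisfies EQ3's hypotheses

Cell `res-hironaka`, LADDER-RESOLUTION rung L (D-0089), slot W4.5(b), crux chain w45b: child crux **EL♮(3)** =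
stmt-ResolutionOfSingularities-20148; registered nose residue `stub_elnat_three_nonisolated_nonUnobsNonHostedNestNoseBTriplePrime`
(39th, CHILD v45 d73c58dccb65cdf1). WIDTH seat res-L1-w45b-nose-w1 g3 (D-0157 DOOR 1), desk R52 / WIDTH TABLE D6: this small
DEF-FREE file composes row (D6-1) = `Equinodal.exists_equinodal_lift` (✓ p670351, this seat) with row (D6-2) = EQ3
`NodeChart.node_strictTransform_chart` (✓ p669509, res-L1-w45b-nose-w2): the output of the former at one marked vector
`n = (n₀, n₁, 1)` — `g(n) = 0`, `∂₀g(n) = ∂₁g(n) = 0`, affine Hessian `H₀₀H₁₁ − H₀₁²` a unit — is turned into the input of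
the latter for the NODE CHART `G := g(u + n₀, v + n₁, 1) ∈ O[u, v]` (dehomogenise at `x₂ = 1`, translate the marked
vector to the origin): `coeff 0 G = 0`, `coeff u G = coeff v G = 0`, `b² − 4ac` a unit (`= −(H₀₀H₁₁ − H₀₁²)` since
`∂ᵤ∂ᵤG(0) = 2a`, `∂ᵤ∂ᵥG(0) = b`, `∂ᵥ∂ᵥG(0) = 2c` — every characteristic). `--supports stmt-ResolutionOfSingularities-20148
--as helper`, counted 0. OURS; nothing of [Hironaka2017] asserted; AI-written, AI review weaker than expert review;
no `sorry`, standard axioms; EL♮(3) NOT proved; resolution in char p NOT proved (dim 3 = Cossart–Piltant 2008/2009).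

WHAT. `eval_zero_aeval_nodeShift` (`G(0) = g(n)`), `pderiv_aeval_nodeShift` (`∂_r G = (∂_r g)` shifted, chain rule of
file B `pderiv_aeval_eq_sum`), `coeff_single_aeval_nodeShift` (linear Taylor coefficients = `∂_r g(n)`),
`eval_pderiv_pderiv_eq_coeff_nodeShift` (quadratic Taylor coefficients, with the factor `2` on the diagonal),
`nodeChart_hypotheses` (EQ3's four hypotheses) and `node_strictTransform_of_equinodal` (EQ3 applied: the strict transform
of `V(G)` under the blow-up of the section `u = v = 0`, chart `u = v u′`, is `v² · G′` with `(G′, ∂G′, v) = (1)` and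
`v ∤ G′`). Stated for ONE marked vector; the door applies it at each `n i`. [folklore polynomial calculus]
-/

set_option linter.dupNamespace false

noncomputable section

open MvPolynomial IsLocalRing

namespace Summit.ResolutionOfSingularities.ResolutionOfSingularities.Cruxes.EquisingularLiftNat.Sections.Equinodal

variable {O : Type*} [CommRing O]

/-- Evaluating the node chart `g(u + n₀, v + n₁, 1)` at the origin is evaluating `g` at `n = (n₀, n₁, 1)`. -/
theorem eval_zero_aeval_nodeShift (g : MvPolynomial (Fin 3) O) (n : Fin 3 → O) (hn : n 2 = 1) :
    eval (0 : Fin 2 → O) (aeval ![X 0 + C (n 0), X 1 + C (n 1), (1 : MvPolynomial (Fin 2) O)] g) = eval n g := by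
  induction g using MvPolynomial.induction_on with
  | C a => simp
  | add p q hp hq => simp only [map_add, hp, hq]
  | mul_X p s hp =>
    rw [map_mul, map_mul, aeval_X, map_mul, hp, eval_X]
    congr 1
    fin_cases s
    · simp
    · simp
    · simp [hn]

/-- The chart partial `∂_r` (`r = 0, 1`) of the node chart is the node chart of `∂_r g`. -/
theorem pderiv_aeval_nodeShift (g : MvPolynomial (Fin 3) O) (n : Fin 3 → O) (r : Fin 2) :
    pderiv r (aeval ![X 0 + C (n 0), X 1 + C (n 1), (1 : MvPolynomial (Fin 2) O)] g) =
      aeval ![X 0 + C (n 0), X 1 + C (n 1), (1 : MvPolynomial (Fin 2) O)] (pderiv (Fin.castSucc r) g) := by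
  classical
  rw [pderiv_aeval_eq_sum]
  have hf : ∀ s : Fin 3, pderiv r (![X 0 + C (n 0), X 1 + C (n 1), (1 : MvPolynomial (Fin 2) O)] s) =
      if s = Fin.castSucc r then 1 else 0 := by
    intro s
    fin_cases s <;> fin_cases r <;> simp
  simp_rw [hf, mul_ite, mul_one, mul_zero]
  rw [Finset.sum_ite_eq' Finset.univ (Fin.castSucc r)]
  simp

/-- First-order Taylor coefficients of the node chart are the chart partials of `g` at `n`. -/
theorem coeff_single_aeval_nodeShift (g : MvPolynomial (Fin 3) O) (n : Fin 3 → O) (hn : n 2 = 1) (r : Fin 2) :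
    coeff (Finsupp.single r 1) (aeval ![X 0 + C (n 0), X 1 + C (n 1), (1 : MvPolynomial (Fin 2) O)] g) =
      eval n (pderiv (Fin.castSucc r) g) := by
  classical
  rw [← eval_zero_aeval_nodeShift _ n hn, ← pderiv_aeval_nodeShift, eval_zero, constantCoeff_eq, coeff_pderiv]
  simp

/-- Second-order Taylor coefficients of the node chart: `∂_r ∂_s g (n) = coeff₀ (∂_r ∂_s G)`, i.e. the mixed coefficient is
`∂₀∂₁ g (n)` and the pure ones carry the factor `2`. -/
theorem eval_pderiv_pderiv_eq_coeff_nodeShift (g : MvPolynomial (Fin 3) O) (n : Fin 3 → O) (hn : n 2 = 1)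
    (r s : Fin 2) :
    eval n (pderiv (Fin.castSucc r) (pderiv (Fin.castSucc s) g)) =
      coeff (Finsupp.single r 1 + Finsupp.single s 1)
        (aeval ![X 0 + C (n 0), X 1 + C (n 1), (1 : MvPolynomial (Fin 2) O)] g) *
        ((Finsupp.single r 1 : Fin 2 →₀ ℕ) s + 1) := by
  classical
  rw [← eval_zero_aeval_nodeShift _ n hn, ← pderiv_aeval_nodeShift, ← pderiv_aeval_nodeShift, eval_zero,
    constantCoeff_eq, coeff_pderiv, coeff_pderiv]
  simp

/-- **JUNCTION (S1) ⟶ EQ3.** From the output of `exists_equinodal_lift` at one marked vector `n` (`n 2 = 1`, `g(n) = 0`,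
`∂₀g(n) = ∂₁g(n) = 0`, affine Hessian `H₀₀H₁₁ − H₀₁²` a unit) the node chart `G := g(u + n₀, v + n₁, 1) ∈ O[u, v]` satisfies
EXACTLY the hypotheses of res-L1-w45b-nose-w2's `NodeChart.node_strictTransform_chart` (✓ p669509): `coeff 0 G = 0`,
`coeff u G = coeff v G = 0` and `b² − 4ac` a unit for the quadratic part `a u² + b uv + c v²` (indeed
`H₀₀H₁₁ − H₀₁² = (2a)(2c) − b² = −(b² − 4ac)`, every characteristic). [OURS · junction of desk R52 rows (D6-1)/(D6-2)] -/
theorem nodeChart_hypotheses (g : MvPolynomial (Fin 3) O) (n : Fin 3 → O) (hn : n 2 = 1)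
    (h0 : eval n g = 0) (h1 : eval n (pderiv 0 g) = 0) (h2 : eval n (pderiv 1 g) = 0)
    (hH : IsUnit (eval n (pderiv 0 (pderiv 0 g)) * eval n (pderiv 1 (pderiv 1 g))
      - eval n (pderiv 0 (pderiv 1 g)) ^ 2)) :
    coeff 0 (aeval ![X 0 + C (n 0), X 1 + C (n 1), (1 : MvPolynomial (Fin 2) O)] g) = 0 ∧
    coeff (Finsupp.single 0 1) (aeval ![X 0 + C (n 0), X 1 + C (n 1), (1 : MvPolynomial (Fin 2) O)] g) = 0 ∧
    coeff (Finsupp.single 1 1) (aeval ![X 0 + C (n 0), X 1 + C (n 1), (1 : MvPolynomial (Fin 2) O)] g) = 0 ∧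
    IsUnit (coeff (Finsupp.single 0 1 + Finsupp.single 1 1)
        (aeval ![X 0 + C (n 0), X 1 + C (n 1), (1 : MvPolynomial (Fin 2) O)] g) ^ 2
      - 4 * coeff (Finsupp.single 0 2) (aeval ![X 0 + C (n 0), X 1 + C (n 1), (1 : MvPolynomial (Fin 2) O)] g)
        * coeff (Finsupp.single 1 2) (aeval ![X 0 + C (n 0), X 1 + C (n 1), (1 : MvPolynomial (Fin 2) O)] g)) := by
  classical
  refine ⟨?_, ?_, ?_, ?_⟩
  · rw [← eval_zero_aeval_nodeShift g n hn] at h0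
    rwa [eval_zero, constantCoeff_eq] at h0
  · rw [coeff_single_aeval_nodeShift g n hn 0]
    simpa using h1
  · rw [coeff_single_aeval_nodeShift g n hn 1]
    simpa using h2
  · set G := aeval ![X 0 + C (n 0), X 1 + C (n 1), (1 : MvPolynomial (Fin 2) O)] g with hG
    have h00 := eval_pderiv_pderiv_eq_coeff_nodeShift g n hn 0 0
    have h11 := eval_pderiv_pderiv_eq_coeff_nodeShift g n hn 1 1
    have h01 := eval_pderiv_pderiv_eq_coeff_nodeShift g n hn 0 1
    rw [← hG] at h00 h11 h01
    rw [← Finsupp.single_add] at h00 h11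
    have hne : (1 : Fin 2) ≠ 0 := by decide
    simp only [Fin.castSucc_zero, Fin.castSucc_one, Finsupp.single_eq_same, Nat.cast_one, Nat.reduceAdd,
      Finsupp.single_eq_of_ne hne, Nat.cast_zero, zero_add, mul_one] at h00 h11 h01
    rw [h00, h11, h01] at hH
    rw [← IsUnit.neg_iff]
    convert hH using 1
    ring

/-- **(S1) ⟶ EQ3, assembled**: for the lift of `exists_equinodal_lift` the node chart at EACH marked vector has a strict
transform which is `O`-smooth along the exceptional curve and has no component in it — `NodeChart.node_strictTransform_chart`
(res-L1-w45b-nose-w2, ✓ p669509) applied to `nodeChart_hypotheses`. [OURS · desk R52 rows (D6-1)+(D6-2) composed] -/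
theorem node_strictTransform_of_equinodal {O : Type} [CommRing O] [Nontrivial O]
    (g : MvPolynomial (Fin 3) O) (n : Fin 3 → O) (hn : n 2 = 1)
    (h0 : eval n g = 0) (h1 : eval n (pderiv 0 g) = 0) (h2 : eval n (pderiv 1 g) = 0)
    (hH : IsUnit (eval n (pderiv 0 (pderiv 0 g)) * eval n (pderiv 1 (pderiv 1 g))
      - eval n (pderiv 0 (pderiv 1 g)) ^ 2)) :
    ∃ G' : MvPolynomial (Fin 2) O,
      aeval (fun i : Fin 2 => if i = 0 then X 0 * X 1 else (X 1 : MvPolynomial (Fin 2) O))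
          (aeval ![X 0 + C (n 0), X 1 + C (n 1), (1 : MvPolynomial (Fin 2) O)] g) = X 1 ^ 2 * G' ∧
      (∃ A B C : MvPolynomial (Fin 2) O, A * G' + B * pderiv 0 G' + C * X 1 = 1) ∧
      ¬ (X 1 ∣ G') := by
  obtain ⟨h00, h10, h01, hdisc⟩ := nodeChart_hypotheses g n hn h0 h1 h2 hH
  exact NodeChart.node_strictTransform_chart O _ h00 h10 h01 hdisc

end Summit.ResolutionOfSingularities.ResolutionOfSingularities.Cruxes.EquisingularLiftNat.Sections.Equinodal
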